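import Mathlib
import HarnessLib
import Summits.Ventures.LatticeQCDFlow.Exactness.ConnectedGroupKickCovering

/-!
# Random-walk kernels compose by convolution; independent kicks of the links of a configuration are a walk on the product group

HONEST FRAMING: exact (Metropolis-corrected) sampling algorithms for lattice gauge theory;
figures of merit are autocorrelation/cost numbers at stated couplings and volumes; no
continuum-physics claim.

Venture `LatticeQCDFlow` (cell pub-lqcd), topic `Exactness`, FANOUT row 9 (eng-latcore, the
engine `latflow.core`: a Metropolis SWEEP kicks the links one after the other; kicks of different
links commute and kicks of the same link in different sweeps compose — the bookkeeping that the
Doeblin certificate of a sweep at a small `nhit` needs, `U1MetropolisSweepErgodic.lean` "NOT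
here").  NEW WORK of the cell over Mathlib (`Measure.mconv`, `Measure.pi`,
`measurePreserving_arrowProdEquivProdArrow`) and the tree (`SymmetricMetropolis.lean`: `mulWalk`;
`InvariantComposition.lean`: `nHit`, `cycle`; `ConnectedGroupKickCovering.lean`: `mulWalk_apply`,
`bind_mulWalk_map_mul_right`).  Nothing here is cited as a fact; no group is special.

THE POINT.  The configuration space `ι → G` of a lattice gauge field is itself a group (pointwise),
and "kick link `l` by `X ∼ ν`, leave the others" is the random walk on it whose step law is the
product law `⊗_j (ν if j = l, δ₁ otherwise)`.  Random-walk kernels compose by CONVOLVING their step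
laws, and product laws convolve coordinate-wise; so any interleaving of independent link kicks is
ONE walk whose step law is the product, over the links, of the convolution powers of the kicks each
link received — order forgotten.

* §1 (any measurable group) `bind_mulWalk_eq_mconv` (`σ`-start, `ρ`-kick ⇒ law `ρ ∗ σ`),
  **`mulWalk_comp_mulWalk`** (`mulWalk ρ ∘ₖ mulWalk σ = mulWalk (ρ ∗ σ)`), `mulWalk_dirac_one`;
  `mconvPow ρ t` (`ρ^{∗0} = δ₁`) with **`nHit_mulWalk`** (`(mulWalk ρ)^t = mulWalk ρ^{∗t}`),
  `mconvPow_eq_nHit_one`, `mconvPow_add`, `mconvPow_mul`, `mconvPow_dirac_one`;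
  **`cycle_map_mulWalk`** — a cycle of walks is the walk of the folded convolution;
  `smul_nHit_le_nHit` — statewise minorants `c • Φ ≤ κ` give `c^t • Φ^t ≤ κ^t`.
* §2 (the product group `ι → G`, `ι` finite) **`pi_mconv_pi`** — `(⊗ f_j) ∗ (⊗ g_j) = ⊗ (f_j ∗ g_j)`;
  `mconvPow_pi`; **`pi_update_dirac_eq_map_update`** — `⊗_j (ν if j = l, δ₁ else) = ν ∘ (x ↦ 1[l ↦ x])⁻¹`;
  `foldr_mconv_pi_update` — folding the one-link laws over a scan `L` gives
  `⊗_j ν_j^{∗ count j L}`-type products (stated with a general per-link law).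

NOT CLAIMED: anything about acceptance steps (that is `MetropolisSweepErgodic.lean`); rates.
-/

noncomputable section

namespace Summit.Ventures.LatticeQCDFlow.Exactness

open MeasureTheory ProbabilityTheory Set Function
open scoped ENNReal

/-! ## §1 Walks compose by convolution -/

section Walk

variable {G : Type*} [Group G] [MeasurableSpace G] [MeasurableMul₂ G]

/-- **Start with law `σ`, kick by `X ∼ ρ`: the result has law `ρ ∗ σ`.** -/
theorem bind_mulWalk_eq_mconv (ρ σ : Measure G) [SFinite ρ] [SFinite σ] :
    σ.bind (mulWalk ρ) = ρ ∗ₘ σ := by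
  ext s hs
  rw [Measure.bind_apply hs (Kernel.aemeasurable _), Measure.mconv, Measure.map_apply measurable_mul hs,
    Measure.prod_apply_symm (measurable_mul hs)]
  refine lintegral_congr fun y => ?_
  rw [mulWalk_apply, Measure.map_apply (measurable_mul_const y) hs]
  rfl

/-- **Random-walk kernels compose by convolving their step laws**: `mulWalk ρ ∘ₖ mulWalk σ = mulWalk (ρ ∗ σ)`
(first `σ`, then `ρ`: `X (Y u) = (X Y) u`). -/
theorem mulWalk_comp_mulWalk (ρ σ : Measure G) [SFinite ρ] [SFinite σ] :
    mulWalk ρ ∘ₖ mulWalk σ = mulWalk (ρ ∗ₘ σ) := by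
  refine Kernel.ext fun u => ?_
  rw [Kernel.comp_apply, mulWalk_apply σ, bind_mulWalk_map_mul_right, bind_mulWalk_eq_mconv, mulWalk_apply]

/-- The walk with the trivial step is the identity kernel. -/
theorem mulWalk_dirac_one : mulWalk (Measure.dirac (1 : G)) = Kernel.id := by
  refine Kernel.ext fun u => ?_
  rw [mulWalk_apply, Measure.map_dirac' (measurable_mul_const u), one_mul, Kernel.id_apply]

/-- The `t`-fold convolution power of a step law (`ρ^{∗0} = δ₁`, `ρ^{∗(t+1)} = ρ ∗ ρ^{∗t}`). -/
def mconvPow (ρ : Measure G) : ℕ → Measure G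
  | 0 => Measure.dirac 1
  | t + 1 => ρ ∗ₘ mconvPow ρ t

omit [MeasurableMul₂ G] in
/-- `ρ^{∗0} = δ₁`. -/
@[simp] theorem mconvPow_zero (ρ : Measure G) : mconvPow ρ 0 = Measure.dirac 1 := rfl

omit [MeasurableMul₂ G] in
/-- `ρ^{∗(t+1)} = ρ ∗ ρ^{∗t}`. -/
theorem mconvPow_succ (ρ : Measure G) (t : ℕ) : mconvPow ρ (t + 1) = ρ ∗ₘ mconvPow ρ t := rfl

/-- Convolution powers of a probability law are probability laws. -/
instance isProbabilityMeasure_mconvPow (ρ : Measure G) [IsProbabilityMeasure ρ] :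
    ∀ t, IsProbabilityMeasure (mconvPow ρ t)
  | 0 => by rw [mconvPow_zero]; infer_instance
  | t + 1 => by
      haveI := isProbabilityMeasure_mconvPow ρ t
      rw [mconvPow_succ]; infer_instance

/-- Convolution powers of an s-finite law are s-finite. -/
instance sFinite_mconvPow (ρ : Measure G) [SFinite ρ] : ∀ t, SFinite (mconvPow ρ t)
  | 0 => by rw [mconvPow_zero]; infer_instance
  | t + 1 => by
      haveI := sFinite_mconvPow ρ t
      rw [mconvPow_succ]; infer_instance

/-- **`t` steps of the walk are ONE step with the `t`-th convolution power.** -/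
theorem nHit_mulWalk (ρ : Measure G) [SFinite ρ] : ∀ t, nHit (mulWalk ρ) t = mulWalk (mconvPow ρ t)
  | 0 => by rw [nHit_zero, mconvPow_zero, mulWalk_dirac_one]
  | t + 1 => by rw [nHit_succ, nHit_mulWalk ρ t, mconvPow_succ, mulWalk_comp_mulWalk]

/-- The convolution power is the law of `t` steps from the identity. -/
theorem mconvPow_eq_nHit_one (ρ : Measure G) [SFinite ρ] (t : ℕ) : mconvPow ρ t = nHit (mulWalk ρ) t 1 := by
  rw [nHit_mulWalk, mulWalk_apply]
  have h : (fun x : G => x * 1) = id := funext fun x => mul_one x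
  rw [h, Measure.map_id]

/-- `δ₁^{∗t} = δ₁`. -/
theorem mconvPow_dirac_one : ∀ t, mconvPow (Measure.dirac (1 : G)) t = Measure.dirac 1
  | 0 => rfl
  | t + 1 => by rw [mconvPow_succ, mconvPow_dirac_one t, Measure.dirac_one_mconv]

/-- `ρ^{∗(a+b)} = ρ^{∗a} ∗ ρ^{∗b}`. -/
theorem mconvPow_add (ρ : Measure G) [SFinite ρ] (a b : ℕ) :
    mconvPow ρ (a + b) = mconvPow ρ a ∗ₘ mconvPow ρ b := by
  induction a with
  | zero => rw [Nat.zero_add, mconvPow_zero, Measure.dirac_one_mconv]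
  | succ a ih => rw [Nat.succ_add, mconvPow_succ, mconvPow_succ, ih, Measure.mconv_assoc]

/-- `ρ^{∗(a b)} = (ρ^{∗a})^{∗b}`. -/
theorem mconvPow_mul (ρ : Measure G) [SFinite ρ] (a : ℕ) : ∀ b : ℕ, mconvPow ρ (a * b) = mconvPow (mconvPow ρ a) b
  | 0 => by rw [Nat.mul_zero, mconvPow_zero, mconvPow_zero]
  | b + 1 => by rw [Nat.mul_succ, Nat.add_comm, mconvPow_add, mconvPow_mul ρ a b, mconvPow_succ]

omit [MeasurableMul₂ G] in
/-- The folded convolution of a list of s-finite laws is s-finite. -/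
theorem sFinite_foldr_mconv {κι : Type*} (σ : κι → Measure G) [∀ i, SFinite (σ i)] :
    ∀ L : List κι, SFinite (L.foldr (fun i acc => σ i ∗ₘ acc) (Measure.dirac 1))
  | [] => by rw [List.foldr_nil]; infer_instance
  | i :: L => by
      haveI := sFinite_foldr_mconv σ L
      rw [List.foldr_cons]; infer_instance

/-- The folded convolution of a list of probability laws is a probability law. -/
theorem isProbabilityMeasure_foldr_mconv {κι : Type*} (σ : κι → Measure G) [∀ i, IsProbabilityMeasure (σ i)] :
    ∀ L : List κι, IsProbabilityMeasure (L.foldr (fun i acc => σ i ∗ₘ acc) (Measure.dirac 1))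
  | [] => by rw [List.foldr_nil]; infer_instance
  | i :: L => by
      haveI := isProbabilityMeasure_foldr_mconv σ L
      rw [List.foldr_cons]; infer_instance

/-- **A cycle of walks is the walk of the folded convolution** (first list member applied last). -/
theorem cycle_map_mulWalk {κι : Type*} (σ : κι → Measure G) [∀ i, SFinite (σ i)] :
    ∀ L : List κι, cycle (L.map fun i => mulWalk (σ i)) =
      mulWalk (L.foldr (fun i acc => σ i ∗ₘ acc) (Measure.dirac 1))
  | [] => by rw [List.map_nil, cycle_nil, List.foldr_nil, mulWalk_dirac_one]
  | i :: L => by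
      haveI := sFinite_foldr_mconv σ L
      rw [List.map_cons, cycle_cons, cycle_map_mulWalk σ L, List.foldr_cons, mulWalk_comp_mulWalk]

end Walk

section Minorant

variable {α : Type*} [MeasurableSpace α]

/-- **Statewise minorants survive powers**: `c • Φ a ≤ κ a` for all `a` gives `c^t • Φ^t a ≤ κ^t a`. -/
theorem smul_nHit_le_nHit {κ Φ : Kernel α α} {c : ℝ≥0∞} (h : ∀ a, c • Φ a ≤ κ a) :
    ∀ (t : ℕ) (a : α), c ^ t • nHit Φ t a ≤ nHit κ t a
  | 0, a => by simp
  | t + 1, a => by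
      rw [nHit_succ, nHit_succ, pow_succ]
      exact comp_minorised (smul_nHit_le_nHit h t) h a

end Minorant

/-! ## §2 The product group of configurations: product laws convolve coordinate-wise -/

section PiGroup

variable {ι : Type*} [Fintype ι] {G : Type*} [Group G] [MeasurableSpace G] [MeasurableMul₂ G]

/-- **Product laws convolve coordinate-wise** on the product group: `(⊗ f_j) ∗ (⊗ g_j) = ⊗ (f_j ∗ g_j)`
(independent coordinates multiply independently). -/
theorem pi_mconv_pi (f g : ι → Measure G) [∀ j, IsProbabilityMeasure (f j)] [∀ j, IsProbabilityMeasure (g j)] :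
    Measure.pi f ∗ₘ Measure.pi g = Measure.pi fun j => f j ∗ₘ g j := by
  refine (Measure.pi_eq fun s hs => ?_).symm
  have hbox : MeasurableSet ((fun p : (ι → G) × (ι → G) => p.1 * p.2) ⁻¹' Set.pi univ s) :=
    measurable_mul (MeasurableSet.univ_pi hs)
  rw [Measure.mconv, Measure.map_apply measurable_mul (MeasurableSet.univ_pi hs),
    ← (measurePreserving_arrowProdEquivProdArrow G G ι f g).measure_preimage hbox.nullMeasurableSet]
  have hpre : (MeasurableEquiv.arrowProdEquivProdArrow G G ι) ⁻¹'
      ((fun p : (ι → G) × (ι → G) => p.1 * p.2) ⁻¹' Set.pi univ s) =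
      Set.pi univ fun j => (fun q : G × G => q.1 * q.2) ⁻¹' s j := by
    ext z
    simp only [mem_preimage, mem_univ_pi]
    exact forall_congr' fun j => Iff.rfl
  rw [hpre, Measure.pi_pi]
  refine Finset.prod_congr rfl fun j _ => ?_
  rw [Measure.mconv, Measure.map_apply measurable_mul (hs j)]

/-- Convolution powers of a product law are the product of the coordinate powers (`t ≥ 1`; at
`t = 0` both sides are `δ₁` up to `⊗ δ₁ = δ₁`). -/
theorem mconvPow_pi_succ (f : ι → Measure G) [∀ j, IsProbabilityMeasure (f j)] :
    ∀ t : ℕ, mconvPow (Measure.pi f) (t + 1) = Measure.pi fun j => mconvPow (f j) (t + 1)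
  | 0 => by
      simp only [mconvPow_succ, mconvPow_zero, Measure.mconv_dirac_one]
  | t + 1 => by
      haveI : ∀ j, IsProbabilityMeasure (mconvPow (f j) (t + 1)) := fun j => isProbabilityMeasure_mconvPow _ _
      rw [mconvPow_succ, mconvPow_pi_succ f t, pi_mconv_pi]
      rfl

variable [DecidableEq ι]

/-- A family `δ₁` everywhere except the law `ν` at `l` is a family of σ-finite (probability) laws. -/
instance isProbabilityMeasure_update_dirac (ν : Measure G) [IsProbabilityMeasure ν] (l j : ι) :
    IsProbabilityMeasure (Function.update (fun _ : ι => Measure.dirac (1 : G)) l ν j) := by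
  by_cases h : j = l
  · subst h; rw [Function.update_self]; infer_instance
  · rw [Function.update_of_ne h]; infer_instance

omit [MeasurableMul₂ G] in
/-- **The one-link kick law as a product law**: `⊗_j (ν if j = l, δ₁ otherwise) = ν ∘ (x ↦ 1[l ↦ x])⁻¹`. -/
theorem pi_update_dirac_eq_map_update (ν : Measure G) [IsProbabilityMeasure ν] (l : ι) :
    Measure.pi (Function.update (fun _ : ι => Measure.dirac (1 : G)) l ν) =
      ν.map (Function.update (1 : ι → G) l) := by
  refine Measure.pi_eq fun s hs => ?_
  rw [Measure.map_apply (measurable_update _) (MeasurableSet.univ_pi hs),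
    Finset.prod_eq_mul_prod_sdiff_singleton_of_mem (Finset.mem_univ l), Function.update_self]
  have hrest : ∏ j ∈ Finset.univ \ {l}, (Function.update (fun _ : ι => Measure.dirac (1 : G)) l ν j) (s j) =
      ∏ j ∈ Finset.univ \ {l}, (s j).indicator 1 1 := by
    refine Finset.prod_congr rfl fun j hj => ?_
    have hjl : j ≠ l := by simpa using (Finset.mem_sdiff.1 hj).2
    rw [Function.update_of_ne hjl, Measure.dirac_apply' _ (hs j)]
  rw [hrest]
  by_cases hone : ∀ j ∈ Finset.univ \ {l}, (1 : G) ∈ s j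
  · rw [Finset.prod_eq_one fun j hj => by rw [indicator_of_mem (hone j hj), Pi.one_apply], mul_one]
    congr 1
    ext x
    simp only [mem_preimage, mem_univ_pi]
    refine ⟨fun h => by simpa using h l, fun hx j => ?_⟩
    by_cases hj : j = l
    · subst hj; simpa using hx
    · rw [Function.update_of_ne hj, Pi.one_apply]
      exact hone j (Finset.mem_sdiff.2 ⟨Finset.mem_univ j, by simpa using hj⟩)
  · push Not at hone
    obtain ⟨j, hj, hj1⟩ := hone
    have hjl : j ≠ l := by simpa using (Finset.mem_sdiff.1 hj).2
    rw [Finset.prod_eq_zero hj (by rw [indicator_of_notMem hj1]), mul_zero]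
    refine measure_mono_null (fun x hx => ?_) (measure_empty (μ := ν))
    have h := (mem_univ_pi.1 (mem_preimage.1 hx)) j
    rw [Function.update_of_ne hjl, Pi.one_apply] at h
    exact absurd h hj1

omit [Fintype ι] in
/-- Powers of the one-link law stay one-link laws: `(δ₁,…,ν,…,δ₁)_j^{∗t} = (δ₁,…,ν^{∗t},…,δ₁)_j`. -/
theorem mconvPow_update_dirac (ν : Measure G) [SFinite ν] (l j : ι) (t : ℕ) :
    mconvPow (Function.update (fun _ : ι => Measure.dirac (1 : G)) l ν j) t =
      Function.update (fun _ : ι => Measure.dirac (1 : G)) l (mconvPow ν t) j := by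
  by_cases h : j = l
  · subst h; rw [Function.update_self, Function.update_self]
  · rw [Function.update_of_ne h, Function.update_of_ne h, mconvPow_dirac_one]

/-- **Folding one-link kick laws over a scan gives a product law of per-link convolution powers**:
with per-link step laws `ρ`, `foldr (l ↦ (⊗(ρ if ·=l, δ₁)) ∗ ·) δ₁ L = ⊗_j ρ^{∗ count j L}`. -/
theorem foldr_mconv_pi_update (ρ : Measure G) [IsProbabilityMeasure ρ] :
    ∀ L : List ι, L.foldr (fun l acc => Measure.pi (Function.update (fun _ : ι => Measure.dirac (1 : G)) l ρ) ∗ₘ acc)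
        (Measure.pi fun _ : ι => Measure.dirac (1 : G)) =
      Measure.pi fun j => mconvPow ρ (L.count j)
  | [] => by
      simp only [List.foldr_nil, List.count_nil, mconvPow_zero]
  | l :: L => by
      haveI : ∀ j, IsProbabilityMeasure (mconvPow ρ (L.count j)) := fun j => isProbabilityMeasure_mconvPow _ _
      rw [List.foldr_cons, foldr_mconv_pi_update ρ L, pi_mconv_pi]
      congr 1
      funext j
      by_cases h : j = l
      · subst h
        rw [List.count_cons_self, Function.update_self, mconvPow_succ]
      · rw [Function.update_of_ne h, Measure.dirac_one_mconv, List.count_cons_of_ne (fun hlj => h hlj.symm)]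

end PiGroup

end Summit.Ventures.LatticeQCDFlow.Exactness
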